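import Mathlib
import HarnessLib
import Literature.Analysis.Asymptotics.SequenceConvolutionAsymptotics
import Summits.NavierStokesRegularity.NavierStokesRegularity.Theorems.TaylorModelRungThreeSoundnessDefs

/-!
# Line `taylor-model` on crux K1b-DR (`ExactWindowRungThree.DerivativeEnclosureCertificateR`,
# stmt-NavierStokesRegularity-23954) — stub S1 `stub_soundness`, helper 1: the majorant algebra

Toward the registered stub `stub_soundness : TaylorModelSoundness` (skeleton v3 `9391589be9c875b2`,
line owner ns-idea-2 g3; Part A of `S1-PROOFPLAN.md`). For a system `IsMajorantSystem n Q w b T U`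
(`Theorems/TaylorModelRungThreeSoundnessDefs.lean`: the hypotheses of S1 — `Q` linear in each argument with
the WEIGHTED bilinear bound `|Q u v|_c ≤ b·Nu·Nv·w_c`, and the abstract Taylor / variational jets `T x k`,
`U x v k` obeying the Cauchy-product recursions of `u' = Q(u,u)`) the method-of-majorants coefficient
bounds are proved by strong induction on the recursions (majorant equation `y' = b y²`, `y(0) = m`,
`y = m/(1 - b m s) = Σ m (bm)^k s^k`; the factor `k+1` of the recursion is cancelled EXACTLY by the `k+1`
summands, no Catalan loss):

* `T_bound`      `|T x k|_c ≤ m (bm)^k w_c` for `|x| ≤ m w`;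
* `U_bound`      `|U x v k|_c ≤ (k+1) ρ (bm)^k w_c` for `|v| ≤ ρ w`;
* `T_sub_bound`  `|T (x+v) k - T x k|_c ≤ ((m+ρ)(b(m+ρ))^k - m(bm)^k) w_c` (first difference);
* `U_sub_bound`  `|U (x+v) z k - U x z k|_c ≤ (k+1) ζ ((b(m+ρ))^k - (bm)^k) w_c` (variation of the variation);
* `T_taylor2_bound` `|T (x+v) k - T x k - U x v k|_c ≤ ((m+ρ)(b(m+ρ))^k - m(bm)^k - (k+1)ρ(bm)^k) w_c`
  (second-order remainder: the coefficients of `g(m+ρ) - g(m) - ρ g'(m)`, `g(y) = y/(1 - b y s)`);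
* `U_add`, `U_smul` — linearity of the variational jets in the direction.

MODEL-lattice bookkeeping only (rung TL-M3 of the NS ladder); nothing here is a statement about the
Navier–Stokes equations.
-/

noncomputable section

-- the sub-problem namespace repeats the summit name by design (D-0017)
set_option linter.dupNamespace false

namespace Summit.NavierStokesRegularity.NavierStokesRegularity.Theorems.TaylorModelMajorant

open scoped BigOperators
open Finset

/-! ### Two arithmetic helpers -/

/-- Division step of the majorant inductions: if `(k+1)·a = Σ_{i≤k} f i`, `|f i| ≤ g i` and
`Σ g ≤ (k+1)·B`, then `|a| ≤ B`. [folklore] -/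
theorem abs_le_of_mul_eq_sum {k : ℕ} {a B : ℝ} {f g : ℕ → ℝ}
    (he : ((k : ℝ) + 1) * a = ∑ i ∈ range (k + 1), f i) (hf : ∀ i ∈ range (k + 1), |f i| ≤ g i)
    (hg : ∑ i ∈ range (k + 1), g i ≤ ((k : ℝ) + 1) * B) : |a| ≤ B := by
  have hk : (0 : ℝ) < (k : ℝ) + 1 := by positivity
  have : ((k : ℝ) + 1) * |a| ≤ ((k : ℝ) + 1) * B := by
    calc ((k : ℝ) + 1) * |a| = |((k : ℝ) + 1) * a| := by rw [abs_mul, abs_of_pos hk]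
      _ = |∑ i ∈ range (k + 1), f i| := by rw [he]
      _ ≤ ∑ i ∈ range (k + 1), |f i| := abs_sum_le_sum_abs _ _
      _ ≤ ∑ i ∈ range (k + 1), g i := sum_le_sum hf
      _ ≤ _ := hg
  exact le_of_mul_le_mul_left this hk

/-- `Σ_{i ≤ k} (k-i+1) = (k+1)(k+2)/2` (reflection of the tree's `Literature.Analysis.sum_range_succ_cast_add_one`).
[folklore] -/
theorem sum_range_cast_sub_add_one (k : ℕ) :
    ∑ i ∈ range (k + 1), (((k - i : ℕ) : ℝ) + 1) = ((k : ℝ) + 1) * ((k : ℝ) + 2) / 2 := by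
  rw [← Literature.Analysis.sum_range_succ_cast_add_one k,
    ← sum_range_reflect (fun i => ((i : ℕ) : ℝ) + 1) (k + 1)]
  simp only [Nat.add_sub_cancel]

variable {n : ℕ} {Q : (Fin n → ℝ) → (Fin n → ℝ) → Fin n → ℝ} {w : Fin n → ℝ} {b : ℝ}
  {T : (Fin n → ℝ) → ℕ → Fin n → ℝ} {U : (Fin n → ℝ) → (Fin n → ℝ) → ℕ → Fin n → ℝ}

/-- Weighted bound of a sum `x + v`. [folklore] -/
theorem wbound_add {x v : Fin n → ℝ} {m ρ : ℝ} (hx : ∀ c, |x c| ≤ m * w c)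
    (hv : ∀ c, |v c| ≤ ρ * w c) : ∀ c, |(x + v) c| ≤ (m + ρ) * w c := fun c => by
  rw [Pi.add_apply, add_mul]
  exact (abs_add_le _ _).trans (add_le_add (hx c) (hv c))

namespace IsMajorantSystem

variable (h : IsMajorantSystem n Q w b T U)
include h

/-! ### Bilinearity rewrites -/

/-- Additivity of `Q` in the first argument. [folklore] -/
theorem Q_add_left (u u' v : Fin n → ℝ) : Q (u + u') v = Q u v + Q u' v :=
  (h.linear_left v).map_add u u'

/-- Additivity of `Q` in the second argument. [folklore] -/
theorem Q_add_right (u v v' : Fin n → ℝ) : Q u (v + v') = Q u v + Q u v' :=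
  (h.linear_right u).map_add v v'

/-- `Q (u - u') v = Q u v - Q u' v`. [folklore] -/
theorem Q_sub_left (u u' v : Fin n → ℝ) : Q (u - u') v = Q u v - Q u' v :=
  (h.linear_left v).map_sub u u'

/-- `Q u (v - v') = Q u v - Q u v'`. [folklore] -/
theorem Q_sub_right (u v v' : Fin n → ℝ) : Q u (v - v') = Q u v - Q u v' :=
  (h.linear_right u).map_sub v v'

/-- Homogeneity of `Q` in the first argument. [folklore] -/
theorem Q_smul_left (r : ℝ) (u v : Fin n → ℝ) : Q (r • u) v = r • Q u v :=
  (h.linear_left v).map_smul r u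

/-- Homogeneity of `Q` in the second argument. [folklore] -/
theorem Q_smul_right (r : ℝ) (u v : Fin n → ℝ) : Q u (r • v) = r • Q u v :=
  (h.linear_right u).map_smul r v

/-! ### The weighted bilinear bound without sign side conditions -/

/-- A weighted component bound forces a nonnegative radius (the weights are positive). [folklore] -/
theorem nonneg_of_wbound {u : Fin n → ℝ} {N : ℝ} (c : Fin n) (hu : |u c| ≤ N * w c) : 0 ≤ N := by
  have h0 : 0 * w c ≤ N * w c := by rw [zero_mul]; exact (abs_nonneg _).trans hu
  exact le_of_mul_le_mul_right h0 (h.w_pos c)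

/-- The weighted bilinear bound `|Q u v|_c ≤ b·Nu·Nv·w_c` (the radii are automatically `≥ 0`).
[folklore] -/
theorem bound' {u v : Fin n → ℝ} {Nu Nv : ℝ} (hu : ∀ c, |u c| ≤ Nu * w c)
    (hv : ∀ c, |v c| ≤ Nv * w c) (c : Fin n) : |Q u v c| ≤ b * Nu * Nv * w c :=
  h.bound u v Nu Nv (h.nonneg_of_wbound c (hu c)) (h.nonneg_of_wbound c (hv c)) hu hv c

/-! ### A1 · Taylor jets: `|T x k| ≤ m (bm)^k w` -/

/-- **Cauchy majorant of the Taylor jets**: `|x| ≤ m·w` implies `|T x k|_c ≤ m (b m)^k w_c` — the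
coefficients of the majorant `m/(1 - b m s)`. [folklore] -/
theorem T_bound {x : Fin n → ℝ} {m : ℝ} (hx : ∀ c, |x c| ≤ m * w c) :
    ∀ (k : ℕ) (c : Fin n), |T x k c| ≤ m * (b * m) ^ k * w c := by
  intro k
  induction k using Nat.strong_induction_on with
  | _ k ih =>
    intro c
    cases k with
    | zero => simpa [h.T_zero] using hx c
    | succ k =>
      refine abs_le_of_mul_eq_sum (h.T_succ x k c) (g := fun _ => m * (b * m) ^ (k + 1) * w c) ?_ ?_
      · intro i hi
        obtain ⟨j, rfl⟩ := Nat.exists_eq_add_of_le (Nat.lt_succ_iff.mp (mem_range.mp hi))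
        rw [Nat.add_sub_cancel_left]
        calc |Q (T x i) (T x j) c|
            ≤ b * (m * (b * m) ^ i) * (m * (b * m) ^ j) * w c :=
              h.bound' (ih i (by omega)) (ih j (by omega)) c
          _ = m * (b * m) ^ (i + j + 1) * w c := by ring
      · rw [sum_const, card_range, nsmul_eq_mul]
        push_cast
        exact le_rfl

/-! ### A2 · variational jets: `|U x v k| ≤ (k+1) ρ (bm)^k w` -/

/-- **Majorant of the variational jets**: `|x| ≤ m·w`, `|v| ≤ ρ·w` imply
`|U x v k|_c ≤ (k+1) ρ (b m)^k w_c` — the coefficients of `ρ/(1 - b m s)²`. [folklore] -/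
theorem U_bound {x v : Fin n → ℝ} {m ρ : ℝ} (hx : ∀ c, |x c| ≤ m * w c)
    (hv : ∀ c, |v c| ≤ ρ * w c) :
    ∀ (k : ℕ) (c : Fin n), |U x v k c| ≤ ((k : ℝ) + 1) * ρ * (b * m) ^ k * w c := by
  have hT := h.T_bound hx
  intro k
  induction k using Nat.strong_induction_on with
  | _ k ih =>
    intro c
    cases k with
    | zero => simpa [h.U_zero] using hv c
    | succ k =>
      refine abs_le_of_mul_eq_sum (h.U_succ x v k c)
        (g := fun i => 2 * ((((k - i : ℕ) : ℝ) + 1) * (ρ * (b * m) ^ (k + 1) * w c))) ?_ ?_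
      · intro i hi
        obtain ⟨j, rfl⟩ := Nat.exists_eq_add_of_le (Nat.lt_succ_iff.mp (mem_range.mp hi))
        rw [Nat.add_sub_cancel_left]
        calc |Q (T x i) (U x v j) c + Q (U x v j) (T x i) c|
            ≤ |Q (T x i) (U x v j) c| + |Q (U x v j) (T x i) c| := abs_add_le _ _
          _ ≤ b * (m * (b * m) ^ i) * (((j : ℝ) + 1) * ρ * (b * m) ^ j) * w c +
                b * (((j : ℝ) + 1) * ρ * (b * m) ^ j) * (m * (b * m) ^ i) * w c :=
              add_le_add (h.bound' (hT i) (ih j (by omega)) c) (h.bound' (ih j (by omega)) (hT i) c)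
          _ = 2 * (((j : ℝ) + 1) * (ρ * (b * m) ^ (i + j + 1) * w c)) := by ring
      · have hs := sum_range_cast_sub_add_one k
        refine le_of_eq ?_
        calc ∑ i ∈ range (k + 1), 2 * ((((k - i : ℕ) : ℝ) + 1) * (ρ * (b * m) ^ (k + 1) * w c))
            = 2 * (ρ * (b * m) ^ (k + 1) * w c) *
                ∑ i ∈ range (k + 1), (((k - i : ℕ) : ℝ) + 1) := by
              rw [mul_sum]
              exact sum_congr rfl fun i _ => by ring
          _ = _ := by rw [hs]; push_cast; ring

/-! ### A3 · first difference of the Taylor jets -/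

/-- **First-difference majorant**: `|x| ≤ m·w`, `|v| ≤ ρ·w` imply
`|T (x+v) k - T x k|_c ≤ ((m+ρ)(b(m+ρ))^k - m (bm)^k) w_c` (coefficients of `g(m+ρ) - g(m)`,
`g(y) = y/(1 - b y s)`). [folklore] -/
theorem T_sub_bound {x v : Fin n → ℝ} {m ρ : ℝ} (hx : ∀ c, |x c| ≤ m * w c)
    (hv : ∀ c, |v c| ≤ ρ * w c) :
    ∀ (k : ℕ) (c : Fin n), |T (x + v) k c - T x k c| ≤
      ((m + ρ) * (b * (m + ρ)) ^ k - m * (b * m) ^ k) * w c := by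
  have hT := h.T_bound hx
  have hT' := h.T_bound (wbound_add hx hv)
  intro k
  induction k using Nat.strong_induction_on with
  | _ k ih =>
    intro c
    cases k with
    | zero => simpa [h.T_zero] using hv c
    | succ k =>
      have he : ((k : ℝ) + 1) * (T (x + v) (k + 1) c - T x (k + 1) c) =
          ∑ i ∈ range (k + 1), (Q (T (x + v) i) (T (x + v) (k - i)) c - Q (T x i) (T x (k - i)) c) := by
        rw [mul_sub, h.T_succ, h.T_succ, ← sum_sub_distrib]
      refine abs_le_of_mul_eq_sum he
        (g := fun _ => ((m + ρ) * (b * (m + ρ)) ^ (k + 1) - m * (b * m) ^ (k + 1)) * w c) ?_ ?_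
      · intro i hi
        obtain ⟨j, rfl⟩ := Nat.exists_eq_add_of_le (Nat.lt_succ_iff.mp (mem_range.mp hi))
        rw [Nat.add_sub_cancel_left]
        have split : Q (T (x + v) i) (T (x + v) j) c - Q (T x i) (T x j) c =
            Q (T (x + v) i - T x i) (T (x + v) j) c + Q (T x i) (T (x + v) j - T x j) c := by
          simp only [h.Q_sub_left, h.Q_sub_right, Pi.sub_apply]
          ring
        rw [split]
        calc |Q (T (x + v) i - T x i) (T (x + v) j) c + Q (T x i) (T (x + v) j - T x j) c|
            ≤ |Q (T (x + v) i - T x i) (T (x + v) j) c| + |Q (T x i) (T (x + v) j - T x j) c| :=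
              abs_add_le _ _
          _ ≤ b * ((m + ρ) * (b * (m + ρ)) ^ i - m * (b * m) ^ i) * ((m + ρ) * (b * (m + ρ)) ^ j) * w c
              + b * (m * (b * m) ^ i) * ((m + ρ) * (b * (m + ρ)) ^ j - m * (b * m) ^ j) * w c :=
              add_le_add (h.bound' (ih i (by omega)) (hT' j) c) (h.bound' (hT i) (ih j (by omega)) c)
          _ = ((m + ρ) * (b * (m + ρ)) ^ (i + j + 1) - m * (b * m) ^ (i + j + 1)) * w c := by ring
      · rw [sum_const, card_range, nsmul_eq_mul]
        push_cast
        exact le_rfl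

/-! ### A4 · variation of the variational jets -/

/-- **Second mixed majorant**: `|x| ≤ m·w`, `|v| ≤ ρ·w`, `|z| ≤ ζ·w` imply
`|U (x+v) z k - U x z k|_c ≤ (k+1) ζ ((b(m+ρ))^k - (bm)^k) w_c` (coefficients of
`ζ (g'(m+ρ) - g'(m))`). [folklore] -/
theorem U_sub_bound {x v z : Fin n → ℝ} {m ρ ζ : ℝ} (hx : ∀ c, |x c| ≤ m * w c)
    (hv : ∀ c, |v c| ≤ ρ * w c) (hz : ∀ c, |z c| ≤ ζ * w c) :
    ∀ (k : ℕ) (c : Fin n), |U (x + v) z k c - U x z k c| ≤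
      ((k : ℝ) + 1) * ζ * ((b * (m + ρ)) ^ k - (b * m) ^ k) * w c := by
  have hT := h.T_bound hx
  have hT' := h.T_bound (wbound_add hx hv)
  have hD := h.T_sub_bound hx hv
  have hV := h.U_bound hx hz
  have hV' := h.U_bound (wbound_add hx hv) hz
  intro k
  induction k using Nat.strong_induction_on with
  | _ k ih =>
    intro c
    cases k with
    | zero => simp [h.U_zero]
    | succ k =>
      have he : ((k : ℝ) + 1) * (U (x + v) z (k + 1) c - U x z (k + 1) c) =
          ∑ i ∈ range (k + 1),
            ((Q (T (x + v) i) (U (x + v) z (k - i)) c + Q (U (x + v) z (k - i)) (T (x + v) i) c) -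
              (Q (T x i) (U x z (k - i)) c + Q (U x z (k - i)) (T x i) c)) := by
        rw [mul_sub, h.U_succ, h.U_succ, ← sum_sub_distrib]
      refine abs_le_of_mul_eq_sum he
        (g := fun i => 2 * ((((k - i : ℕ) : ℝ) + 1) *
          (ζ * ((b * (m + ρ)) ^ (k + 1) - (b * m) ^ (k + 1)) * w c))) ?_ ?_
      · intro i hi
        obtain ⟨j, rfl⟩ := Nat.exists_eq_add_of_le (Nat.lt_succ_iff.mp (mem_range.mp hi))
        rw [Nat.add_sub_cancel_left]
        have split : (Q (T (x + v) i) (U (x + v) z j) c + Q (U (x + v) z j) (T (x + v) i) c) -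
            (Q (T x i) (U x z j) c + Q (U x z j) (T x i) c) =
            (Q (T (x + v) i - T x i) (U (x + v) z j) c + Q (T x i) (U (x + v) z j - U x z j) c) +
              (Q (U (x + v) z j - U x z j) (T (x + v) i) c + Q (U x z j) (T (x + v) i - T x i) c) := by
          simp only [h.Q_sub_left, h.Q_sub_right, Pi.sub_apply]
          ring
        rw [split]
        calc |(Q (T (x + v) i - T x i) (U (x + v) z j) c + Q (T x i) (U (x + v) z j - U x z j) c) +
              (Q (U (x + v) z j - U x z j) (T (x + v) i) c + Q (U x z j) (T (x + v) i - T x i) c)|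
            ≤ (|Q (T (x + v) i - T x i) (U (x + v) z j) c| + |Q (T x i) (U (x + v) z j - U x z j) c|) +
              (|Q (U (x + v) z j - U x z j) (T (x + v) i) c| + |Q (U x z j) (T (x + v) i - T x i) c|) :=
              (abs_add_le _ _).trans (add_le_add (abs_add_le _ _) (abs_add_le _ _))
          _ ≤ (b * ((m + ρ) * (b * (m + ρ)) ^ i - m * (b * m) ^ i) *
                  (((j : ℝ) + 1) * ζ * (b * (m + ρ)) ^ j) * w c +
                b * (m * (b * m) ^ i) * (((j : ℝ) + 1) * ζ * ((b * (m + ρ)) ^ j - (b * m) ^ j)) * w c) +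
              (b * (((j : ℝ) + 1) * ζ * ((b * (m + ρ)) ^ j - (b * m) ^ j)) *
                  ((m + ρ) * (b * (m + ρ)) ^ i) * w c +
                b * (((j : ℝ) + 1) * ζ * (b * m) ^ j) *
                  ((m + ρ) * (b * (m + ρ)) ^ i - m * (b * m) ^ i) * w c) :=
              add_le_add
                (add_le_add (h.bound' (hD i) (hV' j) c) (h.bound' (hT i) (ih j (by omega)) c))
                (add_le_add (h.bound' (ih j (by omega)) (hT' i) c) (h.bound' (hV j) (hD i) c))
          _ = 2 * ((((j : ℕ) : ℝ) + 1) *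
                (ζ * ((b * (m + ρ)) ^ (i + j + 1) - (b * m) ^ (i + j + 1)) * w c)) := by ring
      · have hs := sum_range_cast_sub_add_one k
        refine le_of_eq ?_
        calc ∑ i ∈ range (k + 1), 2 * ((((k - i : ℕ) : ℝ) + 1) *
              (ζ * ((b * (m + ρ)) ^ (k + 1) - (b * m) ^ (k + 1)) * w c))
            = 2 * (ζ * ((b * (m + ρ)) ^ (k + 1) - (b * m) ^ (k + 1)) * w c) *
                ∑ i ∈ range (k + 1), (((k - i : ℕ) : ℝ) + 1) := by
              rw [mul_sum]
              exact sum_congr rfl fun i _ => by ring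
          _ = _ := by rw [hs]; push_cast; ring

/-! ### A5 · second-order remainder of the Taylor jets -/

/-- **Second-order majorant**: `|x| ≤ m·w`, `|v| ≤ ρ·w` imply
`|T (x+v) k - T x k - U x v k|_c ≤ ((m+ρ)(b(m+ρ))^k - m(bm)^k - (k+1) ρ (bm)^k) w_c` — the
coefficients of `g(m+ρ) - g(m) - ρ g'(m)`, `g(y) = y/(1 - b y s)`. [folklore] -/
theorem T_taylor2_bound {x v : Fin n → ℝ} {m ρ : ℝ} (hx : ∀ c, |x c| ≤ m * w c)
    (hv : ∀ c, |v c| ≤ ρ * w c) :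
    ∀ (k : ℕ) (c : Fin n), |T (x + v) k c - T x k c - U x v k c| ≤
      ((m + ρ) * (b * (m + ρ)) ^ k - m * (b * m) ^ k - ((k : ℝ) + 1) * ρ * (b * m) ^ k) * w c := by
  have hT := h.T_bound hx
  have hT' := h.T_bound (wbound_add hx hv)
  have hD := h.T_sub_bound hx hv
  have hV := h.U_bound hx hv
  intro k
  induction k using Nat.strong_induction_on with
  | _ k ih =>
    intro c
    cases k with
    | zero => simp [h.T_zero, h.U_zero]
    | succ k =>
      have hr : ∑ i ∈ range (k + 1), Q (U x v (k - i)) (T x i) c =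
          ∑ i ∈ range (k + 1), Q (U x v i) (T x (k - i)) c := by
        rw [← sum_range_reflect (fun i => Q (U x v i) (T x (k - i)) c) (k + 1)]
        refine sum_congr rfl fun i hi => ?_
        have hik : i ≤ k := Nat.lt_succ_iff.mp (mem_range.mp hi)
        simp only [Nat.add_sub_cancel, Nat.sub_sub_self hik]
      have he : ((k : ℝ) + 1) * (T (x + v) (k + 1) c - T x (k + 1) c - U x v (k + 1) c) =
          ∑ i ∈ range (k + 1), (Q (T (x + v) i) (T (x + v) (k - i)) c - Q (T x i) (T x (k - i)) c -
            Q (T x i) (U x v (k - i)) c - Q (U x v i) (T x (k - i)) c) := by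
        rw [mul_sub, mul_sub, h.T_succ, h.T_succ, h.U_succ, sum_add_distrib, hr, sub_add_eq_sub_sub,
          ← sum_sub_distrib, ← sum_sub_distrib, ← sum_sub_distrib]
      refine abs_le_of_mul_eq_sum he
        (g := fun _ => ((m + ρ) * (b * (m + ρ)) ^ (k + 1) - m * (b * m) ^ (k + 1) -
          (((k + 1 : ℕ) : ℝ) + 1) * ρ * (b * m) ^ (k + 1)) * w c) ?_ ?_
      · intro i hi
        obtain ⟨j, rfl⟩ := Nat.exists_eq_add_of_le (Nat.lt_succ_iff.mp (mem_range.mp hi))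
        rw [Nat.add_sub_cancel_left]
        have split : Q (T (x + v) i) (T (x + v) j) c - Q (T x i) (T x j) c -
            Q (T x i) (U x v j) c - Q (U x v i) (T x j) c =
            Q (T (x + v) i - T x i - U x v i) (T (x + v) j) c +
              Q (U x v i) (T (x + v) j - T x j) c + Q (T x i) (T (x + v) j - T x j - U x v j) c := by
          simp only [h.Q_sub_left, h.Q_sub_right, Pi.sub_apply]
          ring
        rw [split]
        calc |Q (T (x + v) i - T x i - U x v i) (T (x + v) j) c +
              Q (U x v i) (T (x + v) j - T x j) c + Q (T x i) (T (x + v) j - T x j - U x v j) c|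
            ≤ |Q (T (x + v) i - T x i - U x v i) (T (x + v) j) c| +
              |Q (U x v i) (T (x + v) j - T x j) c| + |Q (T x i) (T (x + v) j - T x j - U x v j) c| :=
              (abs_add_le _ _).trans (add_le_add (abs_add_le _ _) le_rfl)
          _ ≤ b * ((m + ρ) * (b * (m + ρ)) ^ i - m * (b * m) ^ i - ((i : ℝ) + 1) * ρ * (b * m) ^ i) *
                ((m + ρ) * (b * (m + ρ)) ^ j) * w c +
              b * (((i : ℝ) + 1) * ρ * (b * m) ^ i) *
                ((m + ρ) * (b * (m + ρ)) ^ j - m * (b * m) ^ j) * w c +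
              b * (m * (b * m) ^ i) *
                ((m + ρ) * (b * (m + ρ)) ^ j - m * (b * m) ^ j - ((j : ℝ) + 1) * ρ * (b * m) ^ j) * w c :=
              add_le_add (add_le_add (h.bound' (ih i (by omega)) (hT' j) c) (h.bound' (hV i) (hD j) c))
                (h.bound' (hT i) (ih j (by omega)) c)
          _ = ((m + ρ) * (b * (m + ρ)) ^ (i + j + 1) - m * (b * m) ^ (i + j + 1) -
                (((i + j + 1 : ℕ) : ℝ) + 1) * ρ * (b * m) ^ (i + j + 1)) * w c := by
              push_cast
              ring
      · rw [sum_const, card_range, nsmul_eq_mul]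
        push_cast
        exact le_rfl

/-! ### A6 · linearity of the variational jets in the direction -/

/-- `U x (z + z') k = U x z k + U x z' k`. [folklore] -/
theorem U_add (x z z' : Fin n → ℝ) : ∀ k, U x (z + z') k = U x z k + U x z' k := by
  intro k
  induction k using Nat.strong_induction_on with
  | _ k ih =>
    cases k with
    | zero => simp [h.U_zero]
    | succ k =>
      funext c
      have hk : ((k : ℝ) + 1) ≠ 0 := by positivity
      apply mul_left_cancel₀ hk
      rw [Pi.add_apply, mul_add, h.U_succ, h.U_succ, h.U_succ, ← sum_add_distrib]
      refine sum_congr rfl fun i _ => ?_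
      rw [ih (k - i) (by omega), h.Q_add_right, h.Q_add_left]
      simp only [Pi.add_apply]
      ring

/-- `U x (r • z) k = r • U x z k`. [folklore] -/
theorem U_smul (x z : Fin n → ℝ) (r : ℝ) : ∀ k, U x (r • z) k = r • U x z k := by
  intro k
  induction k using Nat.strong_induction_on with
  | _ k ih =>
    cases k with
    | zero => simp [h.U_zero]
    | succ k =>
      funext c
      have hk : ((k : ℝ) + 1) ≠ 0 := by positivity
      apply mul_left_cancel₀ hk
      rw [Pi.smul_apply, smul_eq_mul, mul_left_comm, h.U_succ, h.U_succ, mul_sum]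
      refine sum_congr rfl fun i _ => ?_
      rw [ih (k - i) (by omega), h.Q_smul_right, h.Q_smul_left]
      simp only [Pi.smul_apply, smul_eq_mul]
      ring

end IsMajorantSystem


end Summit.NavierStokesRegularity.NavierStokesRegularity.Theorems.TaylorModelMajorant

end
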